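import Mathlib.NumberTheory.LegendreSymbol.JacobiSymbol
import Mathlib.Data.ZMod.Basic
import HarnessLib

set_option linter.dupNamespace false -- `Summit.BirchSwinnertonDyer.BirchSwinnertonDyer.Theorems.…` (summit = sub)
set_option autoImplicit false

/-!
# Route `BiquadraticEisensteinDescent`, crux `HeegnerTwistCouplingInSupply` (stmt-BirchSwinnertonDyer-21381) —
# crux idea `disjoint-divisibility-pigeonhole`: residue-class bookkeeping for the density input S3

Cell `pub/bsd-wall`, width-prover seat `bsd-wall-cm-bed-w4` g24 (explicit-unit, `--supports stmt-BirchSwinnertonDyer-21381`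
as helper). Elementary counting of residue classes, used by the companion file `…HeegnerSplitDensity.lean` to PROVE the
card's density step S3 (`HeegnerSplitDensity`, typed in `…DisjointDivisibilityDefs.lean`): «a fixed fraction of the Heegner
discriminants for `N₀` below `Y` also has the prime `p` split».

For a level `N₀` write `M = 8N₀` and call a residue `c (mod M)` ADMISSIBLE when `(c/q) = 1` for every odd prime `q ∣ N₀`
(the Heegner condition at the odd primes of `N₀`, read on `d ≡ c`); the classes with `c ≡ 1 (mod 8)` in addition make `2`
split. PROVED here (pure arithmetic of `Finset.range`, Jacobi symbols and the Chinese remainder theorem):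

* `jacobiSym_natCast_mod_of_dvd` — `(c mod m / q) = (c / q)` for `q ∣ m`;
* `card_filter_mod_eight_le_of_odd` — for ODD `N₀` and every `a`, the admissible classes `c (mod 8N₀)` with `c ≡ a (mod 8)`
  are at most as many as those with `c ≡ 1 (mod 8)` (shift by a multiple of `N₀`); hence
  `card_filter_admissible_le_eight_mul` — all admissible classes `≤ 8 ×` (admissible with `c ≡ 1 (mod 8)`);
* `sq_modEq_inj_of_le_half` — `t² ≡ t'² (mod p)`, `1 ≤ t, t' ≤ (p−1)/2` ⇒ `t = t'`;
* `card_mul_half_le_card_filter_split` — for an odd prime `p ∤ N₀`: (admissible classes mod `8N₀` with `c ≡ 1 (8)`) ×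
  `(p−1)/2 ≤` (classes mod `8N₀p` with `c ≡ 1 (8)`, admissible, AND `(c/p) = 1`) (CRT with the squares `t²`, `t ≤ (p−1)/2`).

No definition, no named fact; nothing here mentions curves, `L`-values or class numbers. BSD is not proved by any of this.
-/

namespace Summit.BirchSwinnertonDyer.BirchSwinnertonDyer.Theorems.DisjointDivisibility

open scoped Classical

open Finset

/-! ## §1 Jacobi symbols on residues -/

/-- `(c mod m / q) = (c / q)` when `q ∣ m` (the Jacobi symbol depends on the top entry modulo the bottom one). [folklore] -/
theorem jacobiSym_natCast_mod_of_dvd (c m q : ℕ) (hq : q ∣ m) :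
    jacobiSym ((c % m : ℕ) : ℤ) q = jacobiSym (c : ℤ) q := by
  apply jacobiSym.mod_left'
  push_cast
  exact Int.emod_emod_of_dvd _ (Int.natCast_dvd_natCast.2 hq)

/-- `(a / q) = (b / q)` for `a ≡ b (mod q)` in `ℕ`. [folklore] -/
theorem jacobiSym_eq_of_natModEq {a b q : ℕ} (h : a ≡ b [MOD q]) :
    jacobiSym (a : ℤ) q = jacobiSym (b : ℤ) q := by
  apply jacobiSym.mod_left'
  have h' : ((a % q : ℕ) : ℤ) = ((b % q : ℕ) : ℤ) := by rw [h]
  push_cast at h'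
  exact h'

/-! ## §2 Admissible classes modulo `8N₀`: all residues mod `8` are equally populated (odd `N₀`) -/

/-- For odd `N₀`: `N₀² ≡ 1 (mod 8)`. [folklore] -/
theorem mul_self_mod_eight_of_odd {N₀ : ℕ} (hN₀ : Odd N₀) : N₀ * N₀ % 8 = 1 := by
  have h : N₀ % 8 = 1 ∨ N₀ % 8 = 3 ∨ N₀ % 8 = 5 ∨ N₀ % 8 = 7 := by
    obtain ⟨m, rfl⟩ := hN₀; omega
  rw [Nat.mul_mod]
  rcases h with h | h | h | h <;> rw [h]

/-- **Shift lemma.** For ODD `N₀` and any `a`, the admissible residues `c (mod 8N₀)` with `c ≡ a (mod 8)` inject into those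
with `c ≡ 1 (mod 8)` by `c ↦ c + N₀k (mod 8N₀)` with `N₀k ≡ 1 − a (mod 8)` (`k = N₀(9 − a) mod 8`, using `N₀² ≡ 1 (8)`); the
shift is `≡ 0 (mod q)` for every `q ∣ N₀`, so admissibility is preserved. [folklore] -/
theorem card_filter_mod_eight_le_of_odd {N₀ : ℕ} (hN₀ : Odd N₀) (a : ℕ) :
    ((range (8 * N₀)).filter (fun c : ℕ => c % 8 = a ∧
        ∀ q : ℕ, q.Prime → q ∣ N₀ → q ≠ 2 → jacobiSym (c : ℤ) q = 1)).card ≤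
    ((range (8 * N₀)).filter (fun c : ℕ => c % 8 = 1 ∧
        ∀ q : ℕ, q.Prime → q ∣ N₀ → q ≠ 2 → jacobiSym (c : ℤ) q = 1)).card := by
  rcases le_or_gt 8 a with ha | ha
  · rw [Finset.filter_eq_empty_iff.mpr (fun c _ h => by have := Nat.mod_lt c (by norm_num : 0 < 8); omega),
      card_empty]
    exact Nat.zero_le _
  set k : ℕ := N₀ * (9 - a) % 8 with hk
  set s : ℕ := N₀ * k with hs
  have hM : 0 < 8 * N₀ := by obtain ⟨m, rfl⟩ := hN₀; omega
  have hsmod : s % 8 = (9 - a) % 8 := by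
    calc s % 8 = N₀ % 8 * (N₀ * (9 - a) % 8 % 8) % 8 := by rw [hs, hk, Nat.mul_mod]
      _ = N₀ % 8 * (N₀ * (9 - a) % 8) % 8 := by rw [Nat.mod_mod]
      _ = N₀ * (N₀ * (9 - a)) % 8 := (Nat.mul_mod _ _ _).symm
      _ = N₀ * N₀ * (9 - a) % 8 := by rw [Nat.mul_assoc]
      _ = N₀ * N₀ % 8 * ((9 - a) % 8) % 8 := Nat.mul_mod _ _ _
      _ = (9 - a) % 8 := by rw [mul_self_mod_eight_of_odd hN₀, one_mul, Nat.mod_mod]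
  refine Finset.card_le_card_of_injOn (fun c => (c + s) % (8 * N₀)) ?_ ?_
  · intro c hc
    rw [mem_coe, mem_filter, mem_range] at hc ⊢
    obtain ⟨_, hca, hJ⟩ := hc
    refine ⟨Nat.mod_lt _ hM, ?_, ?_⟩
    · rw [Nat.mod_mod_of_dvd _ (Dvd.intro N₀ rfl)]
      omega
    · intro q hq hqN hq2
      rw [jacobiSym_natCast_mod_of_dvd _ _ _ (Dvd.dvd.mul_left hqN 8)]
      have hmod : c + s ≡ c [MOD q] := by
        have hqs : q ∣ s := Dvd.dvd.mul_right hqN k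
        calc c + s ≡ c + 0 [MOD q] := Nat.ModEq.add_left c ((Nat.modEq_zero_iff_dvd.2 hqs))
          _ = c := by rw [add_zero]
      rw [jacobiSym_eq_of_natModEq hmod]
      exact hJ q hq hqN hq2
  · intro c hc c' hc' h
    rw [mem_coe, mem_filter, mem_range] at hc hc'
    have h' : c + s ≡ c' + s [MOD 8 * N₀] := h
    exact Nat.ModEq.eq_of_lt_of_lt (Nat.ModEq.add_right_cancel' s h') hc.1 hc'.1

/-- For ODD `N₀`: the admissible residues `c (mod 8N₀)` number at most `8 ×` those with `c ≡ 1 (mod 8)`. [folklore] -/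
theorem card_filter_admissible_le_eight_mul {N₀ : ℕ} (hN₀ : Odd N₀) :
    ((range (8 * N₀)).filter (fun c : ℕ =>
        ∀ q : ℕ, q.Prime → q ∣ N₀ → q ≠ 2 → jacobiSym (c : ℤ) q = 1)).card ≤
    8 * ((range (8 * N₀)).filter (fun c : ℕ => c % 8 = 1 ∧
        ∀ q : ℕ, q.Prime → q ∣ N₀ → q ≠ 2 → jacobiSym (c : ℤ) q = 1)).card := by
  have hcover : (range (8 * N₀)).filter (fun c : ℕ =>
        ∀ q : ℕ, q.Prime → q ∣ N₀ → q ≠ 2 → jacobiSym (c : ℤ) q = 1) ⊆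
      (range 8).biUnion (fun a : ℕ => (range (8 * N₀)).filter (fun c : ℕ => c % 8 = a ∧
        ∀ q : ℕ, q.Prime → q ∣ N₀ → q ≠ 2 → jacobiSym (c : ℤ) q = 1)) := by
    intro c hc
    rw [mem_filter] at hc
    rw [mem_biUnion]
    exact ⟨c % 8, mem_range.2 (Nat.mod_lt _ (by norm_num)), mem_filter.2 ⟨hc.1, rfl, hc.2⟩⟩
  calc _ ≤ ((range 8).biUnion (fun a : ℕ => (range (8 * N₀)).filter (fun c : ℕ => c % 8 = a ∧
          ∀ q : ℕ, q.Prime → q ∣ N₀ → q ≠ 2 → jacobiSym (c : ℤ) q = 1))).card := card_le_card hcover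
    _ ≤ ∑ a ∈ range 8, ((range (8 * N₀)).filter (fun c : ℕ => c % 8 = a ∧
          ∀ q : ℕ, q.Prime → q ∣ N₀ → q ≠ 2 → jacobiSym (c : ℤ) q = 1)).card := card_biUnion_le
    _ ≤ ∑ _a ∈ range 8, ((range (8 * N₀)).filter (fun c : ℕ => c % 8 = 1 ∧
          ∀ q : ℕ, q.Prime → q ∣ N₀ → q ≠ 2 → jacobiSym (c : ℤ) q = 1)).card :=
        sum_le_sum (fun a _ => card_filter_mod_eight_le_of_odd hN₀ a)
    _ = _ := by rw [sum_const, card_range, smul_eq_mul]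

/-! ## §3 The classes modulo `8N₀p` with `p` split: CRT with the squares -/

/-- `t² ≡ t'² (mod p)` with `1 ≤ t, t' ≤ (p − 1)/2` forces `t = t'` (`p` prime): in `𝔽_p`, `t = ±t'`, and `t + t' < p`.
[folklore] -/
theorem sq_modEq_inj_of_le_half {p t t' : ℕ} (hp : p.Prime) (ht1 : 1 ≤ t) (ht : t ≤ (p - 1) / 2)
    (ht1' : 1 ≤ t') (ht' : t' ≤ (p - 1) / 2) (h : t * t ≡ t' * t' [MOD p]) : t = t' := by
  haveI := Fact.mk hp
  have hZ : ((t : ZMod p)) ^ 2 = ((t' : ZMod p)) ^ 2 := by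
    have := (ZMod.natCast_eq_natCast_iff' (t * t) (t' * t') p).2 h
    push_cast at this
    rw [sq, sq]
    exact this
  rcases sq_eq_sq_iff_eq_or_eq_neg.1 hZ with h1 | h1
  · have h2 : t % p = t' % p := (ZMod.natCast_eq_natCast_iff' t t' p).1 h1
    rw [Nat.mod_eq_of_lt (by omega), Nat.mod_eq_of_lt (by omega)] at h2
    exact h2
  · have h2 : ((t + t' : ℕ) : ZMod p) = 0 := by push_cast; rw [h1, neg_add_cancel]
    rw [ZMod.natCast_eq_zero_iff] at h2
    have := Nat.le_of_dvd (by omega) h2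
    omega

/-- An odd prime `p ∤ N₀` is coprime to `8N₀`. [folklore] -/
theorem coprime_eight_mul_of_prime {N₀ p : ℕ} (hp : p.Prime) (hp2 : p ≠ 2) (hpN : ¬ p ∣ N₀) :
    (8 * N₀).Coprime p := by
  rw [Nat.Coprime, Nat.gcd_comm]
  refine (hp.coprime_iff_not_dvd).2 fun h => ?_
  rcases (Nat.Prime.dvd_mul hp).1 h with h8 | hN
  · have h2 : p ∣ 2 := hp.dvd_of_dvd_pow (show p ∣ 2 ^ 3 by simpa using h8)
    exact hp2 ((Nat.prime_dvd_prime_iff_eq hp Nat.prime_two).1 h2)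
  · exact hpN hN

/-- **CRT injection.** For an odd prime `p ∤ N₀` (`N₀ > 0`): (admissible classes `c (mod 8N₀)` with `c ≡ 1 (mod 8)`) ×
`(p − 1)/2 ≤` the number of classes `c (mod 8N₀p)` with `c ≡ 1 (mod 8)`, admissible for `N₀`, and `(c/p) = 1` — map
`(r, t) ↦ CRT(r mod 8N₀, t² mod p)`, `1 ≤ t ≤ (p−1)/2`, injective by `sq_modEq_inj_of_le_half`. [folklore] -/
theorem card_mul_half_le_card_filter_split {N₀ p : ℕ} (hN₀ : 0 < N₀) (hp : p.Prime) (hp2 : p ≠ 2)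
    (hpN : ¬ p ∣ N₀) :
    ((range (8 * N₀)).filter (fun c : ℕ => c % 8 = 1 ∧
        ∀ q : ℕ, q.Prime → q ∣ N₀ → q ≠ 2 → jacobiSym (c : ℤ) q = 1)).card * ((p - 1) / 2) ≤
    ((range (8 * N₀ * p)).filter (fun c : ℕ => c % 8 = 1 ∧
        (∀ q : ℕ, q.Prime → q ∣ N₀ → q ≠ 2 → jacobiSym (c : ℤ) q = 1) ∧ jacobiSym (c : ℤ) p = 1)).card := by
  have hcop : (8 * N₀).Coprime p := coprime_eight_mul_of_prime hp hp2 hpN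
  have hM0 : 8 * N₀ ≠ 0 := by omega
  set f : ℕ × ℕ → ℕ := fun rt => (Nat.chineseRemainder hcop rt.1 (rt.2 * rt.2) : ℕ) with hf
  have key : (((range (8 * N₀)).filter (fun c : ℕ => c % 8 = 1 ∧
        ∀ q : ℕ, q.Prime → q ∣ N₀ → q ≠ 2 → jacobiSym (c : ℤ) q = 1)) ×ˢ Icc 1 ((p - 1) / 2)).card ≤
      ((range (8 * N₀ * p)).filter (fun c : ℕ => c % 8 = 1 ∧
        (∀ q : ℕ, q.Prime → q ∣ N₀ → q ≠ 2 → jacobiSym (c : ℤ) q = 1) ∧ jacobiSym (c : ℤ) p = 1)).card := by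
    refine Finset.card_le_card_of_injOn f ?_ ?_
    · rintro ⟨r, t⟩ hrt
      rw [mem_coe, mem_product, mem_filter, mem_range, mem_Icc] at hrt
      rw [mem_coe, mem_filter, mem_range]
      obtain ⟨⟨_, hr8, hJ⟩, ht1, ht2⟩ := hrt
      have hc := (Nat.chineseRemainder hcop r (t * t)).2
      refine ⟨Nat.chineseRemainder_lt_mul hcop r (t * t) hM0 hp.ne_zero, ?_, ?_, ?_⟩
      · have h8 : f (r, t) ≡ r [MOD 8] := hc.1.of_mul_right N₀
        unfold Nat.ModEq at h8
        omega
      · intro q hq hqN hq2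
        have hcq : f (r, t) ≡ r [MOD q] := hc.1.of_dvd (Dvd.dvd.mul_left hqN 8)
        rw [jacobiSym_eq_of_natModEq hcq]
        exact hJ q hq hqN hq2
      · rw [jacobiSym_eq_of_natModEq hc.2]
        push_cast
        rw [← sq]
        refine jacobiSym.sq_one' ?_
        rw [Int.gcd_natCast_natCast]
        have : Nat.Coprime p t := (hp.coprime_iff_not_dvd).2 fun h => by
          have := Nat.le_of_dvd (by omega) h; omega
        exact this.symm
    · rintro ⟨r, t⟩ hrt ⟨r', t'⟩ hrt' h
      rw [mem_coe, mem_product, mem_filter, mem_range, mem_Icc] at hrt hrt'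
      have h1 := (Nat.chineseRemainder hcop r (t * t)).2
      have h2 := (Nat.chineseRemainder hcop r' (t' * t')).2
      have h' : (Nat.chineseRemainder hcop r (t * t) : ℕ) = Nat.chineseRemainder hcop r' (t' * t') := h
      have hrr : r ≡ r' [MOD 8 * N₀] := h1.1.symm.trans (h' ▸ h2.1)
      have htt : t * t ≡ t' * t' [MOD p] := h1.2.symm.trans (h' ▸ h2.2)
      have hr_eq : r = r' := Nat.ModEq.eq_of_lt_of_lt hrr hrt.1.1 hrt'.1.1
      have ht_eq : t = t' := sq_modEq_inj_of_le_half hp hrt.2.1 hrt.2.2 hrt'.2.1 hrt'.2.2 htt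
      rw [hr_eq, ht_eq]
  rw [card_product, Nat.card_Icc] at key
  simpa using key

end Summit.BirchSwinnertonDyer.BirchSwinnertonDyer.Theorems.DisjointDivisibility
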